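import Literature.MathematicalPhysics.QuantumFieldTheory.Balaban1983to89.Beta.RemainderConstCertified
import Literature.MathematicalPhysics.QuantumFieldTheory.Balaban1983to89.Beta.RemainderResidueFamily

/-!
# Gaps / CapSignsConstRoad — the CAP of «CAP+tail» on the CONSTANT-REMAINDER road ((D4) = `RemainderConst`): it is again the
# SIGN list as soon as the remainder constant is chosen AFTER the list (the every-slope currency of (D4) — g1-p2's `EpsUniform` ∕
# `EpsFamily` residues, or the linear road (AF-1)), and it is NOT the sign list for a FIXED constant (explicit witness)
# (cell pub-balaban-gaps, seat g1-p3 gen 2, CAP+tail «split ∕ weakening» charge; companion of `Gaps/CapTailSigns.lean` p340075)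

HONEST FRAMING (cell rule, page 1 of everything): bookkeeping over the β sub-cell's hypothesis carriers; NOTHING of Bałaban's is asserted
beyond print; [Balaban1987RG1] Thm 2 is UNPROVED IN PRINT; the finite sign list is the CAP (b2b row CAP-k: certified numerics AT THE
CONSTRUCTION'S OWN `L`, print p. 251 «L odd > 11»; 0 coefficients certified to date); one finite T⁴; 0∕13 main theorems, 0∕9 spine
estimates; NOT `BetaPertH`, NOT the continuum limit, NOT Clay.  HONEST DEPENDENCY (b2b cell, verbatim): «continuum YM on T⁴ ⇐ BetaPertH ∧ nine
spine estimates (0/9 proved); BetaPertH ⇐ (D1) ∧ (D4) ∧ CAP+tail; G-an2-4 gates asym, D1 and NE2/3/4.»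

WHERE THIS SITS.  `Gaps/CapTailSigns.thm2Printed_of_signs` weakened the CAP from thresholds to SIGNS on the LINEAR road ((AF-1)
`|β¹_{k+1}(p)| ≤ C_r·p_k`, carrier `Beta.Assembly.LimitForm`): the box is shrunk after the list.  On the CONSTANT road of the printed chain
([II] (2.38)∕(2.41) → [I] (5.10) → (1.22): `RemainderConst S γ₀ r`, `r = ε₁·K_rem,L`, rows asym2∕an4) the three-lane assembly
`Beta.RemainderConstCertified.thm2Printed_of_certifiedConst` (:409) asks the early coefficients ABOVE THE REMAINDER CONSTANT:
`hsmall : ∀ k < k₂, m₀ ≤ β⁰_{k+1}` with `r < min m₀ (3(m − c₀θ^{k₁})/4)`.  This module records, kernel-checked: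
  * §1 `EverySlope S γc` — the every-slope currency of (D4): `RemainderConst S γ s` at EVERY `s > 0` on SOME box `]0,γ] ⊆ ]0,γc]`.  It is
    supplied BY NAME by g1-p2's object residue `Beta.RemainderResidue.EpsUniform` (`everySlope_of_epsUniform` =
    `exists_remainderConst_le_of_epsUniform`) and by the linear road (AF-1) (`everySlope_of_af1`, `γ = min γ₀ (s/(C+1))`) — so the two
    «CAP = signs» phenomena are ONE: the remainder is made small after the list, by `γ` on the linear road, by `ε₁` on the constant road.
  * §2a THE WEAKEST CAP+tail CURRENCY on this road (EXACT for `BetaAFH`, SUFFICIENT for (0.31)) is ONE predicate on β⁰ — a UNIFORM POSITIVE FLOOR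
    `∃ b > 0, ∀ k, b ≤ β⁰_{k+1}` (NO rate, NO limit value, NO certified enclosure) — paired with `EverySlope`:
    `thm2Printed_of_beta0Floor_everySlope` (= `RemainderConstCertified.thm2Printed_of_floor_const` with `r := b/2` on the produced box),
    `betaAFH_of_beta0Floor_everySlope`, and the CHARACTERISATION `betaAFH_iff_beta0Floor` (under `EverySlope`: `BetaAFH β ↔` floor of β⁰);
    supplier from the three lanes `exists_beta0Floor_of_signs` (tail + ONE certified value + gap + index test + SIGNS ⟹ floor).
  * §2b `thm2Printed_of_signs_everySlope`: the binder list of `thm2Printed_of_certifiedConst` with the above-r list REPLACED by the SIGN list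
    `∀ k < k₂, 0 < β⁰_{k+1}` + the gap `c₀θ^{k₁} < m` + `EverySlope S γc` ⟹ `B12.Thm2Printed C L` (`r :=` half the floor, chosen AFTER the
    list — the printed order «ε₁ sufficiently small» [II] p. 21); β-level forms; the `EpsUniform` corollaries by name.
  * §3 THE SCHEME FORM (Bałaban's order of constants is a choice of a MEMBER `e = ε₁` of a family of constructions, g1-p2's
    `Beta.RemainderResidueFamily.EpsFamily`): if the one-loop coefficients are COMMON to the members (displayed binder `hβ0` — a reading we
    do not adjudicate), tail + one certified value + gap + the SIGN list of that common sequence + `EpsFamily` + per-member (C), (U),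
    forward generation ⟹ SOME member satisfies Theorem 2 as printed (`exists_member_thm2Printed_of_signs`; floor form
    `exists_member_thm2Printed_of_beta0Floor`).
  * §4 THE LOCATED NEGATIVE for a FIXED constant: an explicit split `Witness.splitW` (β⁰ = ½, 4, 4, …; β¹ ≡ −1 on the histories) meeting
    EVERY binder of `thm2Printed_of_certifiedConst` except the above-`r` list — `GeomRate β⁰ 4 (7/2) (1/2)`, certified `4 ≤ β⁰_2` (`k₁ = 1`),
    gap `7/4 < 4`, index `k₂ = 3`, SIGNS `0 < β⁰_{k+1}` (`k < 3`), `RemainderConst splitW γ 1` for every `γ` with `1 < 27/16 = 3(m − c₀θ^{k₁})/4`,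
    (C), (U) — and yet `β_1 ≡ −1/2` on every box: `not_betaLowerH_witness`, `not_betaAFH_witness`, `not_everySlope_witness`.  So on the
    constant road with `r` FIXED the sign list is NOT a CAP currency; `EverySlope` (equivalently: `r` below the listed minimum) is exactly
    what the weakening spends.
All [folklore]; 0 sorry; 0 new hypotheses about Bałaban's objects; imports landed modules only, nothing restated.

CITATION HEADER (lean-in-tree rule; tags CONTEXT ONLY).  [I] = T. Bałaban, Commun. Math. Phys. **109** (1987) 249–301 [Balaban1987RG1]:
Thm 2 p. 259 with (0.31); (1.20)–(1.22) p. 264; (2.12)–(2.14) p. 268; Thm 3 p. 264 («The constant γ depends on all other constants»).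
[II] = T. Bałaban, Commun. Math. Phys. **116** (1988) 1–22 [Balaban1988RG2Cluster]: Lemma 3 (2.38) p. 20; p. 21 «for κ sufficiently large,
and ε₁ sufficiently small».  NO lower bound `β ≥ b > 0`, NO rate and NO finite-k value of (1.22) is printed in the series.
-/

namespace Summit.QuantumFields.BalabanUV.Gaps.CapSignsConstRoad

open Literature.MathematicalPhysics.QuantumFieldTheory.Balaban1983to89
open Literature.MathematicalPhysics.QuantumFieldTheory.Balaban1983to89.FlowStep
open Literature.MathematicalPhysics.QuantumFieldTheory.Balaban1983to89.FlowStepRuns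
open Literature.MathematicalPhysics.QuantumFieldTheory.Balaban1983to89.DagBinding
open Literature.MathematicalPhysics.QuantumFieldTheory.Balaban1983to89.Beta.RemainderChain (RemainderConst)
open Literature.MathematicalPhysics.QuantumFieldTheory.Balaban1983to89.Beta.RateCertificate (GeomRate)
open Literature.MathematicalPhysics.QuantumFieldTheory.Balaban1983to89.Beta.RemainderConstCertified
open Literature.MathematicalPhysics.QuantumFieldTheory.Balaban1983to89.Beta.RemainderResidue
open Literature.MathematicalPhysics.QuantumFieldTheory.Balaban1983to89.Beta.RemainderResidueFamily

noncomputable section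

variable {β : HBeta}

/-! ## §0 Plumbing: the positive minimum of a finite sign list -/

/-- A finite SIGN list `0 < b_k` (`k < n`) has a positive common floor `m₀ ≤ b_k` (`k < n`): `m₀ = min (1, b_0, …, b_{n−1})`. [folklore] -/
theorem exists_pos_floor_of_signs (b : ℕ → ℝ) :
    ∀ n : ℕ, (∀ k, k < n → 0 < b k) → ∃ m₀ : ℝ, 0 < m₀ ∧ ∀ k, k < n → m₀ ≤ b k
  | 0, _ => ⟨1, one_pos, fun k hk => absurd hk (Nat.not_lt_zero k)⟩
  | n + 1, h => by
      obtain ⟨m₀, hm₀, hle⟩ := exists_pos_floor_of_signs b n fun k hk => h k (Nat.lt_succ_of_lt hk)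
      refine ⟨min m₀ (b n), lt_min hm₀ (h n (Nat.lt_succ_self n)), fun k hk => ?_⟩
      rcases Nat.lt_succ_iff_lt_or_eq.mp hk with hk | rfl
      · exact (min_le_left _ _).trans (hle k hk)
      · exact min_le_right _ _

/-! ## §1 `EverySlope` — the every-slope currency of (D4), and its two suppliers by name -/

/-- **`EverySlope S γc` — THE EVERY-SLOPE CURRENCY OF (D4)**: for every `s > 0` there is a box `]0,γ]`, `0 < γ ≤ γc`, with the constant form
`RemainderConst S γ s` (`|β¹_{k+1}| ≤ s` on `]0,γ]^{k+1}`, all k) — the remainder constant below ANY positive number at the price of the box (printed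
order of constants: [I] Thm 3 p. 264 «The constant γ depends on all other constants»; [II] p. 21 «ε₁ sufficiently small»).  A PREDICATE, never
asserted; suppliers §1, scheme form §3.  For Bałaban's FIXED split (one ε₁) NO supplier is in print or tree: that would be the linear road of
[II] p. 8 after (1.29) «Another possibility is to use the expression g_k|B| instead of ε₁. It gives a better bound, but the above is simpler.»
— not carried out in print (tree record `Beta.RemainderChain` header §2; §4 below is the abstract negative).  Split-free reading: k-uniform
continuity of `β` at the zero history along boxes (`Beta.RemainderExplicitSplitUnique.remainderConst_iff_family`). [cite: Balaban1987RG1, Thm 3 p.264] -/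
def EverySlope (S : B12Beta.OneLoopSplit β) (γc : ℝ) : Prop :=
  ∀ s : ℝ, 0 < s → ∃ γ : ℝ, 0 < γ ∧ γ ≤ γc ∧ RemainderConst S γ s

/-- `EverySlope` is monotone in the reference box. [folklore] -/
theorem EverySlope.mono {S : B12Beta.OneLoopSplit β} {γc γc' : ℝ} (h : EverySlope S γc) (hle : γc ≤ γc') : EverySlope S γc' :=
  fun s hs => by
    obtain ⟨γ, hγ, hγle, hR⟩ := h s hs
    exact ⟨γ, hγ, hγle.trans hle, hR⟩

/-- **Supplier 1 (object level, row (D4)): g1-p2's `Beta.RemainderResidue.EpsUniform S` gives `EverySlope S γc` for every `γc > 0`** —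
this is `RemainderResidue.exists_remainderConst_le_of_epsUniform` by name (choose `ε₁ := min ε₀ (s/K)`).
[cite: Balaban1988RG2Cluster, p.21 (after (2.39)); Balaban1987RG1, Thm 3 p.264] -/
theorem everySlope_of_epsUniform {S : B12Beta.OneLoopSplit β} (hE : EpsUniform S) {γc : ℝ} (hγc : 0 < γc) : EverySlope S γc :=
  fun _ hs => exists_remainderConst_le_of_epsUniform hE hs hγc

/-- **Supplier 2 (the linear road): (AF-1) `|β¹_{k+1}(p)| ≤ C·p_k` on `]0,γ₀]`-histories gives `EverySlope S γ₀`** — on the box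
`γ = min γ₀ (s/(C+1))` the constant form holds with constant `C·γ ≤ s` (`RemainderChain.remainderConst_of_af1`).  So `Gaps/CapTailSigns`'s
sign-CAP on the `LimitForm` road and §2 below are one phenomenon. [cite: Balaban1987RG1, §1 p.264] -/
theorem everySlope_of_af1 (S : B12Beta.OneLoopSplit β) {C γ₀ : ℝ} (hγ₀ : 0 < γ₀) (hC : 0 ≤ C)
    (hAF1 : ∀ k (p : Fin (k + 1) → ℝ), p ∈ B12Beta.HistBox γ₀ k → |S.β1 k p| ≤ C * p (Fin.last k)) : EverySlope S γ₀ := by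
  intro s hs
  refine ⟨min γ₀ (s / (C + 1)), lt_min hγ₀ (by positivity), min_le_left _ _, ?_⟩
  have hR : RemainderConst S (min γ₀ (s / (C + 1))) (C * min γ₀ (s / (C + 1))) :=
    Beta.RemainderChain.remainderConst_of_af1 S hC fun k p hp => hAF1 k p fun i => ⟨(hp i).1, (hp i).2.trans (min_le_left _ _)⟩
  have hle : C * min γ₀ (s / (C + 1)) ≤ s :=
    calc C * min γ₀ (s / (C + 1)) ≤ C * (s / (C + 1)) := mul_le_mul_of_nonneg_left (min_le_right _ _) hC
      _ ≤ s := by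
          rw [mul_div_assoc', div_le_iff₀ (by positivity)]
          nlinarith
  exact fun k p hp => (hR k p hp).trans hle

/-! ## §2a The weakest CAP+tail currency on this road: a UNIFORM POSITIVE FLOOR of β⁰ (no rate, no limit value) paired with `EverySlope` -/

/-- **FLOOR ⟹ (AF-0) on some box**: a uniform positive floor `b ≤ β⁰_{k+1}` (all k) and `EverySlope S γc` give `BetaLowerH (b/2) γ β` on some box
`0 < γ ≤ γc` (`RemainderConstCertified.betaLowerH_of_floor_const` with the remainder constant taken `≤ b/2`). [cite: Balaban1987RG1, (2.12)-(2.14) p.268] -/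
theorem exists_betaLowerH_of_beta0Floor_everySlope (S : B12Beta.OneLoopSplit β) {γc b : ℝ} (hb : 0 < b) (hF : ∀ k, b ≤ S.β0 k)
    (hrem : EverySlope S γc) : ∃ γ : ℝ, 0 < γ ∧ γ ≤ γc ∧ BetaLowerH (b / 2) γ β := by
  obtain ⟨γ, hγ, hγle, hR⟩ := hrem _ (half_pos hb)
  refine ⟨γ, hγ, hγle, ?_⟩
  have h := betaLowerH_of_floor_const S hF hR
  convert h using 1
  ring

/-- **`BetaAFH β` from a uniform positive floor of β⁰ + `EverySlope`.** [folklore] -/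
theorem betaAFH_of_beta0Floor_everySlope (S : B12Beta.OneLoopSplit β) {γc b : ℝ} (hb : 0 < b) (hF : ∀ k, b ≤ S.β0 k)
    (hrem : EverySlope S γc) : BetaAFH β := by
  obtain ⟨γ, hγ, -, hR⟩ := hrem _ (half_pos hb)
  exact betaAFH_of_floor_const S hγ hF hR (half_lt_self hb)

/-- **CHARACTERISATION — on the every-slope road, CAP+tail for discrete asymptotic freedom IS the uniform positive floor of β⁰**: under
`EverySlope S γc`, `BetaAFH β ↔ ∃ b > 0, ∀ k, b ≤ β⁰_{k+1}` (⇐ above; ⇒ at the common box corner `β ≥ b` and `|β¹| ≤ b/2` give `β⁰ ≥ b/2`).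
[cite: Balaban1987RG1, (2.12)-(2.14) p.268] -/
theorem betaAFH_iff_beta0Floor (S : B12Beta.OneLoopSplit β) {γc : ℝ} (hrem : EverySlope S γc) :
    BetaAFH β ↔ ∃ b : ℝ, 0 < b ∧ ∀ k, b ≤ S.β0 k := by
  refine ⟨fun ⟨γ₀, hγ₀, b, hb, hlo⟩ => ?_, fun ⟨b, hb, hF⟩ => betaAFH_of_beta0Floor_everySlope S hb hF hrem⟩
  obtain ⟨γ, hγ, -, hR⟩ := hrem _ (half_pos hb)
  refine ⟨b / 2, half_pos hb, fun k => ?_⟩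
  have hv : (fun _ : Fin (k + 1) => min γ γ₀) ∈ Box γ₀ k := mem_box.mpr fun _ => ⟨lt_min hγ hγ₀, min_le_right _ _⟩
  have h1 := hlo k _ hv
  have h2 := (abs_le.mp (hR k _ fun _ => ⟨lt_min hγ hγ₀, min_le_left _ _⟩)).2
  rw [S.split k] at h1
  linarith

/-- **[Balaban1987RG1] THEOREM 2 AS PRINTED FROM THE WEAKEST CAP+tail CURRENCY OF THIS ROAD**: forward generation, `1 < L`, a uniform positive
floor `b ≤ β⁰_{k+1}` (all k; one-loop asymptotic freedom uniform in the scale — NO rate, NO limit value, NO certified enclosure), `EverySlope S γc`,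
(C) and (U) on `]0,γc]` ⟹ `B12.Thm2Printed C L` (`RemainderConstCertified.thm2Printed_of_floor_const` with `r := b/2` on the produced box; (0.31)
lower constant `b/(2 log L)`).  Inputs BY NAME that no printed source supplies: the floor, the every-slope residue, (C).
[cite: Balaban1987RG1, Thm 2 p.259 with (0.31)] -/
theorem thm2Printed_of_beta0Floor_everySlope {C : B12.Construction} (hgen : ForwardGenerated C β) {L : ℝ} (hL : 1 < L)
    (S : B12Beta.OneLoopSplit β) {γc b β' : ℝ} (hb : 0 < b) (hF : ∀ k, b ≤ S.β0 k) (hrem : EverySlope S γc)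
    (hcont : BetaContH γc β) (hup : BetaUpperH β' γc β) : B12.Thm2Printed C L := by
  obtain ⟨γ, hγ, hγle, hR⟩ := hrem _ (half_pos hb)
  exact thm2Printed_of_floor_const hgen hL S hγ hF hR (half_lt_self hb) (fun k => (hcont k).mono (box_mono hγle k))
    (fun k v hv => hup k v (box_mono hγle k hv))

/-- **SUPPLIER of the floor: tail + ONE certified value + gap + index test + the SIGN list** (`RemainderConstCertified.floor_of_cert` with `m₀` the
positive minimum of the listed values, `floor_pos_of_gap`): `∃ f > 0, ∀ k, f ≤ b_k`, `f = min m₀ (3(m − c₀θ^{k₁})/4)`. [folklore] -/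
theorem exists_beta0Floor_of_signs (b : ℕ → ℝ) {binf c₀ θ m : ℝ} {k₁ k₂ : ℕ} (hθ0 : 0 ≤ θ) (hθ1 : θ ≤ 1)
    (hconv : GeomRate b binf c₀ θ) (hcert : m ≤ b k₁) (hgap : c₀ * θ ^ k₁ < m) (hk₂ : c₀ * θ ^ k₂ ≤ (m - c₀ * θ ^ k₁) / 4)
    (hsign : ∀ k, k < k₂ → 0 < b k) : ∃ f : ℝ, 0 < f ∧ ∀ k, f ≤ b k := by
  obtain ⟨m₀, hm₀, hlist⟩ := exists_pos_floor_of_signs b k₂ hsign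
  exact ⟨_, floor_pos_of_gap hgap hm₀, floor_of_cert hconv hθ0 hθ1 hcert hk₂ hlist⟩

/-! ## §2b The SIGN list is the CAP on the constant road in the every-slope currency (tail + one certified value as in the three-lane assembly) -/

/-- **A POSITIVE FLOOR ON SOME BOX FROM THE SIGN LIST, every-slope currency** (β-level): tail + one certified value + gap + index test + the
SIGN list + `EverySlope S γc` ⟹ `0 < γ ≤ γc`, `b = f/2 > 0` with `BetaLowerH b γ β` (§2a on `exists_beta0Floor_of_signs`). [folklore] -/
theorem exists_betaLowerH_of_signs_everySlope (S : B12Beta.OneLoopSplit β) {γc binf c₀ θ m : ℝ} {k₁ k₂ : ℕ} (hθ0 : 0 ≤ θ)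
    (hθ1 : θ ≤ 1) (hconv : GeomRate S.β0 binf c₀ θ) (hcert : m ≤ S.β0 k₁) (hgap : c₀ * θ ^ k₁ < m)
    (hk₂ : c₀ * θ ^ k₂ ≤ (m - c₀ * θ ^ k₁) / 4) (hsign : ∀ k, k < k₂ → 0 < S.β0 k) (hrem : EverySlope S γc) :
    ∃ γ b : ℝ, 0 < γ ∧ γ ≤ γc ∧ 0 < b ∧ BetaLowerH b γ β := by
  obtain ⟨f, hf, hF⟩ := exists_beta0Floor_of_signs S.β0 hθ0 hθ1 hconv hcert hgap hk₂ hsign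
  obtain ⟨γ, hγ, hγle, hlo⟩ := exists_betaLowerH_of_beta0Floor_everySlope S hf hF hrem
  exact ⟨γ, f / 2, hγ, hγle, half_pos hf, hlo⟩

/-- **DISCRETE ASYMPTOTIC FREEDOM `BetaAFH β` FROM THE SIGN LIST, every-slope currency.** [folklore] -/
theorem betaAFH_of_signs_everySlope (S : B12Beta.OneLoopSplit β) {γc binf c₀ θ m : ℝ} {k₁ k₂ : ℕ} (hθ0 : 0 ≤ θ) (hθ1 : θ ≤ 1)
    (hconv : GeomRate S.β0 binf c₀ θ) (hcert : m ≤ S.β0 k₁) (hgap : c₀ * θ ^ k₁ < m)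
    (hk₂ : c₀ * θ ^ k₂ ≤ (m - c₀ * θ ^ k₁) / 4) (hsign : ∀ k, k < k₂ → 0 < S.β0 k) (hrem : EverySlope S γc) : BetaAFH β := by
  obtain ⟨f, hf, hF⟩ := exists_beta0Floor_of_signs S.β0 hθ0 hθ1 hconv hcert hgap hk₂ hsign
  exact betaAFH_of_beta0Floor_everySlope S hf hF hrem

/-- **[Balaban1987RG1] THEOREM 2 AS PRINTED ON THE CONSTANT ROAD FROM THE SIGN LIST** (forward generation, `1 < L`): the binder list of
`RemainderConstCertified.thm2Printed_of_certifiedConst` with the above-`r` list + `r < min m₀ (…)` REPLACED by the SIGN list `0 < β⁰_{k+1}` (`k < k₂`)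
+ the gap `c₀θ^{k₁} < m` + `EverySlope S γc`; (0.31) lower constant `(min m₀ (3(m − c₀θ^{k₁})/4))/(2 log L)`, `m₀` the listed minimum.  Inputs BY
NAME that no printed source supplies: rate, certified value, sign list, every-slope residue, (C). [cite: Balaban1987RG1, Thm 2 p.259 with (0.31)] -/
theorem thm2Printed_of_signs_everySlope {C : B12.Construction} (hgen : ForwardGenerated C β) {L : ℝ} (hL : 1 < L)
    (S : B12Beta.OneLoopSplit β) {γc binf c₀ θ β' m : ℝ} {k₁ k₂ : ℕ} (hθ0 : 0 ≤ θ) (hθ1 : θ ≤ 1)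
    (hconv : GeomRate S.β0 binf c₀ θ) (hcert : m ≤ S.β0 k₁) (hgap : c₀ * θ ^ k₁ < m)
    (hk₂ : c₀ * θ ^ k₂ ≤ (m - c₀ * θ ^ k₁) / 4) (hsign : ∀ k, k < k₂ → 0 < S.β0 k) (hrem : EverySlope S γc)
    (hcont : BetaContH γc β) (hup : BetaUpperH β' γc β) : B12.Thm2Printed C L := by
  obtain ⟨f, hf, hF⟩ := exists_beta0Floor_of_signs S.β0 hθ0 hθ1 hconv hcert hgap hk₂ hsign
  exact thm2Printed_of_beta0Floor_everySlope hgen hL S hf hF hrem hcont hup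

/-- LIST-FREE END STATEMENT on the same road (no sign, no list: the END statement never consumed the CAP — cf. `Gaps/WeakestBetaCurrency`):
tail + one certified value + gap + index test + `EverySlope S γc` + (C), (U), (L) on `]0,γc]` ⟹ `DagBinding.EndpointExistence C`
(`RemainderConstCertified.endpointExistence_of_certifiedConst` with `r :=` half the tail floor). [cite: Balaban1987RG1, Thm 2 p.259 (first sentence)] -/
theorem endpointExistence_of_gap_everySlope {C : B12.Construction} (hgen : ForwardGenerated C β)
    (S : B12Beta.OneLoopSplit β) {γc binf c₀ θ β' m : ℝ} {k₁ k₂ : ℕ} (hθ0 : 0 ≤ θ) (hθ1 : θ ≤ 1)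
    (hconv : GeomRate S.β0 binf c₀ θ) (hcert : m ≤ S.β0 k₁) (hgap : c₀ * θ ^ k₁ < m)
    (hk₂ : c₀ * θ ^ k₂ ≤ (m - c₀ * θ ^ k₁) / 4) (hrem : EverySlope S γc) (hcont : BetaContH γc β)
    (hup : BetaUpperH β' γc β) (hlo : ∀ k, ∀ v ∈ Box γc k, -β' ≤ β k v) : EndpointExistence C := by
  have hf : 0 < 3 * (m - c₀ * θ ^ k₁) / 4 := by linarith
  obtain ⟨γ, hγ, hγle, hR⟩ := hrem _ (half_pos hf)
  exact endpointExistence_of_certifiedConst hgen S hγ hθ0 hθ1 hconv hcert hk₂ hR (half_lt_self hf)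
    (fun k v hv => hup k v (box_mono hγle k hv)) (fun k v hv => hlo k v (box_mono hγle k hv))
    (fun k => (hcont k).mono (box_mono hγle k))

/-- **The `EpsUniform` COROLLARY (row (D4)'s object residue of g1-p2, `Beta.RemainderResidue` p339505, by name)**: `EpsUniform S` + tail + one
certified value + gap + index test + SIGNS + (C), (U) on any box `]0,γc]` ⟹ Theorem 2 as printed.
[cite: Balaban1987RG1, Thm 2 p.259 with (0.31); Balaban1988RG2Cluster, p.21] -/
theorem thm2Printed_of_signs_epsUniform {C : B12.Construction} (hgen : ForwardGenerated C β) {L : ℝ} (hL : 1 < L)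
    (S : B12Beta.OneLoopSplit β) (hE : EpsUniform S) {γc binf c₀ θ β' m : ℝ} {k₁ k₂ : ℕ} (hγc : 0 < γc) (hθ0 : 0 ≤ θ)
    (hθ1 : θ ≤ 1) (hconv : GeomRate S.β0 binf c₀ θ) (hcert : m ≤ S.β0 k₁) (hgap : c₀ * θ ^ k₁ < m)
    (hk₂ : c₀ * θ ^ k₂ ≤ (m - c₀ * θ ^ k₁) / 4) (hsign : ∀ k, k < k₂ → 0 < S.β0 k) (hcont : BetaContH γc β)
    (hup : BetaUpperH β' γc β) : B12.Thm2Printed C L :=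
  thm2Printed_of_signs_everySlope hgen hL S hθ0 hθ1 hconv hcert hgap hk₂ hsign (everySlope_of_epsUniform hE hγc) hcont hup

/-- `BetaAFH β` from `EpsUniform S` + tail + one certified value + gap + index test + SIGNS. [folklore] -/
theorem betaAFH_of_signs_epsUniform (S : B12Beta.OneLoopSplit β) (hE : EpsUniform S) {binf c₀ θ m : ℝ} {k₁ k₂ : ℕ}
    (hθ0 : 0 ≤ θ) (hθ1 : θ ≤ 1) (hconv : GeomRate S.β0 binf c₀ θ) (hcert : m ≤ S.β0 k₁) (hgap : c₀ * θ ^ k₁ < m)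
    (hk₂ : c₀ * θ ^ k₂ ≤ (m - c₀ * θ ^ k₁) / 4) (hsign : ∀ k, k < k₂ → 0 < S.β0 k) : BetaAFH β :=
  betaAFH_of_signs_everySlope S hθ0 hθ1 hconv hcert hgap hk₂ hsign (everySlope_of_epsUniform hE one_pos)

/-! ## §3 The SCHEME form: a family of constructions indexed by the activity parameter, `EpsFamily`, common one-loop part -/

/-- **SOME MEMBER OF THE SCHEME SATISFIES THEOREM 2 AS PRINTED, FROM A UNIFORM POSITIVE FLOOR OF THE COMMON ONE-LOOP PART** (the weakest
CAP+tail currency of §2a in the scheme form): `EpsFamily βf Sf` + the displayed binder `hβ0` (one-loop coefficients common to the members; a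
reading, never asserted) + `0 < b ≤ b0 k` for all k + per-member (C), (U) on a member box + forward generation ⟹ `∃ e > 0, B12.Thm2Printed (Cf e) L`
(the member `e` is the one the family residue gives at slope `b/2`: `RemainderResidueFamily.exists_remainderConst_of_epsFamily`).
[cite: Balaban1987RG1, Thm 2 p.259 with (0.31) and Thm 3 p.264; Balaban1988RG2Cluster, p.21] -/
theorem exists_member_thm2Printed_of_beta0Floor {βf : ℝ → HBeta} {Sf : (e : ℝ) → B12Beta.OneLoopSplit (βf e)}
    (hE : EpsFamily βf Sf) (Cf : ℝ → B12.Construction) (hgen : ∀ e, 0 < e → ForwardGenerated (Cf e) (βf e)) {L : ℝ}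
    (hL : 1 < L) {b0 : ℕ → ℝ} (hβ0 : ∀ e, 0 < e → (Sf e).β0 = b0) {b : ℝ} (hb : 0 < b) (hF : ∀ k, b ≤ b0 k) (γcf β'f : ℝ → ℝ)
    (hγcf : ∀ e, 0 < e → 0 < γcf e) (hcont : ∀ e, 0 < e → BetaContH (γcf e) (βf e))
    (hup : ∀ e, 0 < e → BetaUpperH (β'f e) (γcf e) (βf e)) : ∃ e : ℝ, 0 < e ∧ B12.Thm2Printed (Cf e) L := by
  obtain ⟨e, he, γ₀, hγ₀, hR⟩ := exists_remainderConst_of_epsFamily hE (half_pos hb)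
  refine ⟨e, he, ?_⟩
  have hγ : 0 < min γ₀ (γcf e) := lt_min hγ₀ (hγcf e he)
  have hR' : RemainderConst (Sf e) (min γ₀ (γcf e)) (b / 2) := remainderConst_restrict (min_le_left _ _) hR
  have hF' : ∀ k, b ≤ (Sf e).β0 k := by rw [hβ0 e he]; exact hF
  exact thm2Printed_of_floor_const (hgen e he) hL (Sf e) hγ hF' hR' (half_lt_self hb)
    (fun k => (hcont e he k).mono (box_mono (min_le_right _ _) k))
    (fun k v hv => hup e he k v (box_mono (min_le_right _ _) k hv))

/-- **SOME MEMBER OF THE SCHEME SATISFIES THEOREM 2 AS PRINTED, FROM THE SIGN LIST** — family `e ↦ (βf e, Sf e, Cf e)` indexed by the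
activity parameter `e = ε₁` ([II] p. 21: a choice of `ε₁` is a choice of the construction; g1-p2's scope correction): `EpsFamily βf Sf` (row (D4),
object level) + the displayed binder `hβ0` «the one-loop coefficients (1.22) are COMMON to the members» (a READING this file does NOT adjudicate;
never asserted) + tail, ONE certified value, gap, index test and the SIGN list for that common sequence + per-member (C), (U) + forward
generation ⟹ `∃ e > 0, B12.Thm2Printed (Cf e) L`, the member CHOSEN AFTER the sign list («ε₁ sufficiently small» read against the certified
early coefficients). [cite: Balaban1987RG1, Thm 2 p.259 with (0.31) and Thm 3 p.264; Balaban1988RG2Cluster, p.21] -/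
theorem exists_member_thm2Printed_of_signs {βf : ℝ → HBeta} {Sf : (e : ℝ) → B12Beta.OneLoopSplit (βf e)}
    (hE : EpsFamily βf Sf) (Cf : ℝ → B12.Construction) (hgen : ∀ e, 0 < e → ForwardGenerated (Cf e) (βf e)) {L : ℝ}
    (hL : 1 < L) {b0 : ℕ → ℝ} (hβ0 : ∀ e, 0 < e → (Sf e).β0 = b0) {binf c₀ θ m : ℝ} {k₁ k₂ : ℕ} (hθ0 : 0 ≤ θ)
    (hθ1 : θ ≤ 1) (hconv : GeomRate b0 binf c₀ θ) (hcert : m ≤ b0 k₁) (hgap : c₀ * θ ^ k₁ < m)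
    (hk₂ : c₀ * θ ^ k₂ ≤ (m - c₀ * θ ^ k₁) / 4) (hsign : ∀ k, k < k₂ → 0 < b0 k) (γcf β'f : ℝ → ℝ)
    (hγcf : ∀ e, 0 < e → 0 < γcf e) (hcont : ∀ e, 0 < e → BetaContH (γcf e) (βf e))
    (hup : ∀ e, 0 < e → BetaUpperH (β'f e) (γcf e) (βf e)) : ∃ e : ℝ, 0 < e ∧ B12.Thm2Printed (Cf e) L := by
  obtain ⟨f, hf, hF⟩ := exists_beta0Floor_of_signs b0 hθ0 hθ1 hconv hcert hgap hk₂ hsign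
  exact exists_member_thm2Printed_of_beta0Floor hE Cf hgen hL hβ0 hf hF γcf β'f hγcf hcont hup

/-! ## §4 The located NEGATIVE: with a FIXED remainder constant the sign list is NOT a CAP currency -/

namespace Witness

/-- The witness one-loop sequence: `β⁰_1 = 1/2`, `β⁰_{k+1} = 4` for `k ≥ 1`. [folklore] -/
def b0W (k : ℕ) : ℝ := if k = 0 then 1 / 2 else 4

/-- The witness remainder: `β¹_{k+1}(p) = −1` on histories with `p_k > 0`, `0` otherwise (so that the printed vanishing at `g_k = 0` of
(2.13) holds). [folklore] -/
def b1W (k : ℕ) (p : Fin (k + 1) → ℝ) : ℝ := if 0 < p (Fin.last k) then -1 else 0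

/-- The witness β-family `β_{k+1}(p) = β⁰_{k+1} + β¹_{k+1}(p)`. [folklore] -/
def betaW : HBeta := fun k p => b0W k + b1W k p

/-- Its one-loop split ([I] (2.12)–(2.14) shape). [folklore] -/
def splitW : B12Beta.OneLoopSplit betaW where
  β0 := b0W
  β1 := b1W
  split := fun _ _ => rfl
  vanish := fun k p hp => by simp [b1W, hp]

/-- On a history box the witness remainder is `−1`. [folklore] -/
theorem b1W_eq_of_pos {k : ℕ} {p : Fin (k + 1) → ℝ} (hp : 0 < p (Fin.last k)) : b1W k p = -1 := by
  simp [b1W, hp]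

/-- (asym) the tail: `GeomRate β⁰ 4 (7/2) (1/2)`. [folklore] -/
theorem geomRate_W : GeomRate splitW.β0 4 (7 / 2) (1 / 2) := by
  intro k
  change |b0W k - 4| ≤ 7 / 2 * (1 / 2) ^ k
  rcases Nat.eq_zero_or_pos k with rfl | hk
  · norm_num [b0W]
  · rw [b0W, if_neg (Nat.pos_iff_ne_zero.mp hk)]
    norm_num

/-- (cap, one value) the certified value `4 ≤ β⁰_2` (`k₁ = 1`). [folklore] -/
theorem cert_W : (4 : ℝ) ≤ splitW.β0 1 := by
  change (4 : ℝ) ≤ b0W 1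
  norm_num [b0W]

/-- The index test at `k₂ = 3`: `c₀θ^3 = 7/16 ≤ 9/16 = (m − c₀θ^{k₁})/4`. [folklore] -/
theorem index_W : (7 / 2 : ℝ) * (1 / 2) ^ 3 ≤ (4 - 7 / 2 * (1 / 2) ^ 1) / 4 := by norm_num

/-- (cap) the SIGN list `0 < β⁰_{k+1}` for `k < 3` (indeed for all k). [folklore] -/
theorem signs_W : ∀ k, k < 3 → 0 < splitW.β0 k := fun k _ => by
  change 0 < b0W k
  unfold b0W
  split_ifs <;> norm_num

/-- (asym2∕an4) the constant form with the FIXED constant `r = 1` on EVERY box, and `1 < 27/16 = 3(m − c₀θ^{k₁})/4` — the binder `hr` of the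
list-free ENDs `RemainderConstCertified.endpointExistence_of_certifiedConst` holds. [folklore] -/
theorem remainderConst_W (γ : ℝ) : RemainderConst splitW γ 1 := fun k p hp => by
  change |b1W k p| ≤ 1
  rw [b1W_eq_of_pos (hp (Fin.last k)).1]
  norm_num

/-- `r = 1 < 3(m − c₀θ^{k₁})/4 = 27/16`. [folklore] -/
theorem r_lt_tailFloor_W : (1 : ℝ) < 3 * (4 - 7 / 2 * (1 / 2) ^ 1) / 4 := by norm_num

/-- On every box the witness is the constant `β⁰_{k+1} − 1` in the history. [folklore] -/
theorem betaW_eq_on_box {γ : ℝ} {k : ℕ} {v : Fin (k + 1) → ℝ} (hv : v ∈ Box γ k) : betaW k v = b0W k - 1 := by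
  change b0W k + b1W k v = b0W k - 1
  rw [b1W_eq_of_pos (mem_box.mp hv (Fin.last k)).1]
  ring

/-- (C) joint continuity on every box (the witness is history-constant there). [folklore] -/
theorem betaContH_W (γ : ℝ) : BetaContH γ betaW := fun k =>
  (continuousOn_const (c := b0W k - 1)).congr fun _ hv => betaW_eq_on_box hv

/-- (U) the uniform upper bound `β_{k+1} ≤ 3` on every box. [folklore] -/
theorem betaUpperH_W (γ : ℝ) : BetaUpperH 3 γ betaW := fun k _ hv => by
  rw [betaW_eq_on_box hv]
  unfold b0W
  split_ifs <;> norm_num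

/-- (L) the lower companion `−3 ≤ β_{k+1}` on every box (binder `hlo` of the list-free ENDs). [folklore] -/
theorem betaLowerBd_W (γ : ℝ) : ∀ k, ∀ v ∈ Box γ k, -(3 : ℝ) ≤ betaW k v := fun k _ hv => by
  rw [betaW_eq_on_box hv]
  unfold b0W
  split_ifs <;> norm_num

/-- **THE FIRST β IS NEGATIVE ON EVERY BOX**: `β_1(v) = 1/2 − 1 = −1/2`. [folklore] -/
theorem betaW_zero_eq {γ : ℝ} {v : Fin (0 + 1) → ℝ} (hv : v ∈ Box γ 0) : betaW 0 v = -(1 / 2) := by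
  rw [betaW_eq_on_box hv]
  norm_num [b0W]

/-- **NO NON-NEGATIVE LOWER BOUND ON ANY BOX**: `¬ BetaLowerH b γ betaW` for every `b ≥ 0`, `γ > 0` — although EVERY binder of
`RemainderConstCertified.thm2Printed_of_certifiedConst` holds for `splitW` except the above-`r` list, which is replaced by the SIGN list
(`geomRate_W`, `cert_W`, `index_W`, `signs_W`, `remainderConst_W`, `r_lt_tailFloor_W`, `betaContH_W`, `betaUpperH_W`).  So for a FIXED
remainder constant the sign list is NOT a CAP currency on the constant road. [folklore] -/
theorem not_betaLowerH_witness {b γ : ℝ} (hb : 0 ≤ b) (hγ : 0 < γ) : ¬ BetaLowerH b γ betaW := fun h => by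
  have hmem : (fun _ : Fin (0 + 1) => γ) ∈ Box γ 0 := mem_box.mpr fun _ => ⟨hγ, le_rfl⟩
  have h1 := h 0 _ hmem
  rw [betaW_zero_eq hmem] at h1
  linarith

/-- **NO DISCRETE ASYMPTOTIC FREEDOM for the witness**: `¬ BetaAFH betaW`. [folklore] -/
theorem not_betaAFH_witness : ¬ BetaAFH betaW := fun ⟨_, hγ, _, hb, hlo⟩ => not_betaLowerH_witness hb.le hγ hlo

/-- Consistency with §2: the witness does NOT have the every-slope currency on any box (`RemainderConst splitW γ s` fails for `s < 1`).
[folklore] -/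
theorem not_everySlope_witness {γc : ℝ} : ¬ EverySlope splitW γc := fun h => by
  obtain ⟨γ, hγ, -, hR⟩ := h (1 / 2) (by norm_num)
  have hmem : (fun _ : Fin (0 + 1) => γ) ∈ B12Beta.HistBox γ 0 := fun _ => ⟨hγ, le_rfl⟩
  have h1 := hR 0 _ hmem
  change |b1W 0 (fun _ => γ)| ≤ 1 / 2 at h1
  rw [b1W_eq_of_pos (show (0 : ℝ) < γ from hγ)] at h1
  norm_num at h1

/-- The list-free END road DOES fire for the witness's data shape (all its binders hold: tail, certificate, index, `r = 1 < 27/16`, (U), (L),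
(C)) — what fails is only the POINTWISE floor (0.31) asks for; recorded as the `EventualForm` carrier with `b = 27/16 − 1 = 11/16`, `k₀ = 3`.
[folklore] -/
theorem eventualForm_W_consts :
    (eventualFormOfCertifiedConst splitW (γ₀ := 1) (β' := 3) one_pos (by norm_num) (by norm_num) geomRate_W cert_W index_W
        (remainderConst_W 1) r_lt_tailFloor_W (betaUpperH_W 1) (betaLowerBd_W 1) (betaContH_W 1)).b = 11 / 16 ∧
      (eventualFormOfCertifiedConst splitW (γ₀ := 1) (β' := 3) one_pos (by norm_num) (by norm_num) geomRate_W cert_W index_W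
        (remainderConst_W 1) r_lt_tailFloor_W (betaUpperH_W 1) (betaLowerBd_W 1) (betaContH_W 1)).k₀ = 3 := by
  refine ⟨?_, rfl⟩
  rw [(eventualFormOfCertifiedConst_consts splitW one_pos (by norm_num) (by norm_num) geomRate_W cert_W index_W
    (remainderConst_W 1) r_lt_tailFloor_W (betaUpperH_W 1) (betaLowerBd_W 1) (betaContH_W 1)).1]
  norm_num

end Witness

end

end Summit.QuantumFields.BalabanUV.Gaps.CapSignsConstRoad
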